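import Summits.CriticalPhenomena.PercolationContinuityZ3.Theorems.PercNearOneGluingNoHeavyLowerTailKnQuestion8CoefficientwiseCoreClassKernelMixSigmaFlip
import HarnessLib

/-!
# Cluster facts on an explicit arc (towards THEOREM IET-CYCLE, layer 2)

Support file (`--supports stmt-CriticalPhenomena-4575`, closed), prover `prim-cplus-coupling` (gen 39).  No definitions, no notations, no named facts,
no sorries; standard axioms.  Memo `prim-cplus-coupling/A5-COUPLING-gen39.md` §3.

`…KernelMixTwoArcGlue` reduces THEOREM IET-CYCLE to four facts about clusters on a cycle `A ⊔ W` through `u, b` ((R) two routes, (G⋆), (YJ), (Yσ)).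
This file proves the one-arc facts for an EXPLICIT arc `A = {e 1, …, e L}`, `ends (e t) = s(w (t−1), w t)`, `w 0 = u`, `w L = b`, `w` injective on
`[0, L]`, against an edge set `W` (the other arc) that joins `u` to `b` and touches no interior vertex `w 1, …, w (L−1)`:
* `arc_reach_fwd`, `arc_reach_bwd` — `w t` is reached from `u` along `e 1..e t` and from `b` along `e (t+1)..e L`;
* `arc_cluster_prefix` — if `e t ∉ η ⊆ A` then `C_u(η) ⊆ {w j : j < t}`;
* `arc_W_avoids` — `w j ∉ C_u(W)` for `0 < j < L`;  `arc_cluster_WT` — `C_u(W ∪ T_m) ⊆ C_u(W) ∪ {w j : L − m ≤ j ≤ L}` (`T_m` = last `m` edges);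
* `arc_Gstar` — (G⋆) `C_u((A ∖ T_1) ∪ W) = C_u(A ∪ W)`;
* `arc_YJ` — (YJ) for `η ⊆ A`, `η ≠ A`, `C_u η ≠ {u}`: `C_u(W ∪ (A ∖ η)) ⊆ C_u(W ∪ T_{jb η})`, `jb η = Nat.findGreatest (Disjoint η ∘ T) L`;
* `arc_Ysigma` — (Yσ) for the same `η`: `C_u(W ∪ (A ∖ η)) ⊆ C_u(σ(η) ∪ W)` with the partial swap `σ` of `…KernelMixSigmaFlip`.
[cite: KozmaNitzan2024, Questions 8–9 (§5.5 p. 36) (context: the Question-8 pocket covariance programme)]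
-/

namespace Summit.CriticalPhenomena.PercolationContinuityZ3.Theorems

open Finset Literature.Probability.Percolation

namespace Coefficientwise

variable {ι V : Type*}

open Classical in
/-- Forward reach along an arc: if `e 1, …, e t ∈ ζ` then `w t ∈ C_{w 0}(ζ)`. [cite: KozmaNitzan2024, §5.5 (context only; folklore)] -/
theorem arc_reach_fwd (ends : ι → Sym2 V) (L : ℕ) (w : ℕ → V) (e : ℕ → ι)
    (harc : ∀ t, 1 ≤ t → t ≤ L → ends (e t) = s(w (t - 1), w t)) (ζ : Finset ι) (t : ℕ) (ht : t ≤ L)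
    (hζ : ∀ t', 1 ≤ t' → t' ≤ t → e t' ∈ ζ) :
    w t ∈ openCluster (ends '' (↑ζ : Set ι)) (w 0) := by
  induction t with
  | zero => exact mem_openCluster_self _ _
  | succ t ih =>
    have hprev := ih (by omega) (fun t' h1 h2 => hζ t' h1 (by omega))
    have hedge := harc (t + 1) (by omega) ht
    simp only [Nat.add_sub_cancel] at hedge
    exact mem_openCluster_of_edge ends (hζ (t + 1) (by omega) (le_refl _)) hedge hprev

open Classical in
/-- Backward reach along an arc: if `e (t+1), …, e L ∈ ζ` then `w t ∈ C_{w L}(ζ)`. [cite: KozmaNitzan2024, §5.5 (context only; folklore)] -/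
theorem arc_reach_bwd (ends : ι → Sym2 V) (L : ℕ) (w : ℕ → V) (e : ℕ → ι)
    (harc : ∀ t, 1 ≤ t → t ≤ L → ends (e t) = s(w (t - 1), w t)) (ζ : Finset ι) (t : ℕ) (ht : t ≤ L)
    (hζ : ∀ t', t < t' → t' ≤ L → e t' ∈ ζ) :
    w t ∈ openCluster (ends '' (↑ζ : Set ι)) (w L) := by
  have key : ∀ n t, t + n = L → (∀ t', t < t' → t' ≤ L → e t' ∈ ζ) → w t ∈ openCluster (ends '' (↑ζ : Set ι)) (w L) := by
    intro n
    induction n with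
    | zero =>
      intro t ht _
      have : t = L := by omega
      subst this
      exact mem_openCluster_self _ _
    | succ n ih =>
      intro t ht hζ'
      have hnext := ih (t + 1) (by omega) (fun t' h1 h2 => hζ' t' (by omega) h2)
      have hedge := harc (t + 1) (by omega) (by omega)
      simp only [Nat.add_sub_cancel] at hedge
      exact mem_openCluster_of_edge ends (hζ' (t + 1) (by omega) (by omega)) (hedge.trans Sym2.eq_swap) hnext
  exact key (L - t) t (by omega) hζ

open Classical in
/-- The red cluster along an arc stops at the first missing edge: if `η ⊆ A = {e 1..e L}` and `e t ∉ η` (`1 ≤ t ≤ L`), then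
`C_{w 0}(η) ⊆ {w j : j < t}` (`w` injective on `[0, L]`). [cite: KozmaNitzan2024, §5.5 (context only; folklore)] -/
theorem arc_cluster_prefix (ends : ι → Sym2 V) (L : ℕ) (w : ℕ → V) (e : ℕ → ι)
    (harc : ∀ t, 1 ≤ t → t ≤ L → ends (e t) = s(w (t - 1), w t))
    (hwinj : ∀ i j, i ≤ L → j ≤ L → w i = w j → i = j)
    (A : Finset ι) (hA : ∀ i, i ∈ A ↔ ∃ t, 1 ≤ t ∧ t ≤ L ∧ e t = i)
    (η : Finset ι) (hη : η ⊆ A) (t : ℕ) (ht1 : 1 ≤ t) (htL : t ≤ L) (het : e t ∉ η) :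
    openCluster (ends '' (↑η : Set ι)) (w 0) ⊆ {x | ∃ j, j < t ∧ x = w j} := by
  refine openCluster_subset_of_closed ends η (w 0) (S := {x | ∃ j, j < t ∧ x = w j}) ⟨0, by omega, rfl⟩ ?_
  intro i hi a c hi_ends ⟨j, hj, hja⟩
  obtain ⟨t', ht'1, ht'L, rfl⟩ := (hA i).mp (hη hi)
  have he' := harc t' ht'1 ht'L
  rw [he'] at hi_ends
  -- a = w j is an end of e t' = {w (t'-1), w t'}; so j = t'-1 or j = t'
  have ha : a = w (t' - 1) ∨ a = w t' := by
    have : a ∈ s(w (t' - 1), w t') := by rw [hi_ends]; exact Sym2.mem_mk_left a c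
    exact Sym2.mem_iff.mp this
  have hc : c = w (t' - 1) ∨ c = w t' := by
    have : c ∈ s(w (t' - 1), w t') := by rw [hi_ends]; exact Sym2.mem_mk_right a c
    exact Sym2.mem_iff.mp this
  have ht'lt : t' < t := by
    rcases ha with ha | ha
    · have := hwinj j (t' - 1) (by omega) (by omega) (hja.symm.trans ha)
      -- j = t' - 1 < t ⇒ t' ≤ t; and t' ≠ t since e t ∉ η
      have hne : t' ≠ t := fun h => het (h ▸ hi)
      omega
    · have := hwinj j t' (by omega) ht'L (hja.symm.trans ha)
      omega
  rcases hc with hc | hc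
  · exact ⟨t' - 1, by omega, hc⟩
  · exact ⟨t', ht'lt, hc⟩

open Classical in
/-- The other arc avoids the interior of the arc: if no edge of `W` has an end among `w 1, …, w (L−1)` and `w 0 = u`, then for `0 < j < L`,
`w j ∉ C_u(W)`. [cite: KozmaNitzan2024, §5.5 (context only; folklore)] -/
theorem arc_W_avoids (ends : ι → Sym2 V) (L : ℕ) (w : ℕ → V) (W : Finset ι) (u : V) (hw0 : w 0 = u)
    (hwinj : ∀ i j, i ≤ L → j ≤ L → w i = w j → i = j)
    (hWint : ∀ f ∈ W, ∀ x, x ∈ ends f → ∀ j, 1 ≤ j → j < L → x ≠ w j) (j : ℕ) (hj1 : 1 ≤ j) (hjL : j < L) :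
    w j ∉ openCluster (ends '' (↑W : Set ι)) u := by
  have hsub : openCluster (ends '' (↑W : Set ι)) u ⊆ {x | x = u ∨ ∃ f ∈ W, x ∈ ends f} := by
    refine openCluster_subset_of_closed ends W u (S := {x | x = u ∨ ∃ f ∈ W, x ∈ ends f}) (Or.inl rfl) ?_
    intro i hi a c he _
    exact Or.inr ⟨i, hi, by rw [he]; exact Sym2.mem_mk_right a c⟩
  intro hmem
  rcases hsub hmem with h0 | ⟨f, hf, hx⟩
  · have := hwinj j 0 (by omega) (by omega) (h0.trans hw0.symm); omega
  · exact hWint f hf (w j) hx j hj1 hjL rfl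

open Classical in
/-- The blue cluster of `u` through `W` and a terminal segment of the arc: with `T = {e t : L < t + m}` (the last `m` edges),
`C_u(W ∪ T) ⊆ C_u(W) ∪ {w j : L ≤ j + m, j ≤ L}`, provided `b = w L ∈ C_u(W)` and `W` avoids the interior of the arc.
[cite: KozmaNitzan2024, §5.5 (context only; folklore)] -/
theorem arc_cluster_WT (ends : ι → Sym2 V) (L : ℕ) (w : ℕ → V) (e : ℕ → ι) (W : Finset ι) (u : V) (hw0 : w 0 = u)
    (harc : ∀ t, 1 ≤ t → t ≤ L → ends (e t) = s(w (t - 1), w t))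
    (hWint : ∀ f ∈ W, ∀ x, x ∈ ends f → ∀ j, 1 ≤ j → j < L → x ≠ w j)
    (hbW : w L ∈ openCluster (ends '' (↑W : Set ι)) u)
    (T : Finset ι) (m : ℕ) (hT : ∀ i, i ∈ T → ∃ t, 1 ≤ t ∧ t ≤ L ∧ L < t + m ∧ e t = i) :
    openCluster (ends '' (↑(W ∪ T) : Set ι)) u ⊆ openCluster (ends '' (↑W : Set ι)) u ∪ {x | ∃ j, L ≤ j + m ∧ j ≤ L ∧ x = w j} := by
  refine openCluster_subset_of_closed ends (W ∪ T) u (S := openCluster (ends '' (↑W : Set ι)) u ∪ {x | ∃ j, L ≤ j + m ∧ j ≤ L ∧ x = w j})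
    (Or.inl (mem_openCluster_self _ _)) ?_
  intro i hi a c he ha
  rcases Finset.mem_union.mp hi with hiW | hiT
  · -- an edge of W: if a ∈ C_u(W) then c ∈ C_u(W); if a = w j is an interior/terminal arc vertex then a ∈ {u, b} ⊆ C_u(W) as well
    have haW : a ∈ openCluster (ends '' (↑W : Set ι)) u := by
      rcases ha with ha | ⟨j, hjm, hjL, rfl⟩
      · exact ha
      · by_cases hj0 : j = 0
        · subst hj0; rw [hw0]; exact mem_openCluster_self _ _
        · by_cases hjL' : j = L
          · subst hjL'; exact hbW
          · exact absurd rfl (hWint i hiW (w j) (by rw [he]; exact Sym2.mem_mk_left _ c) j (by omega) (by omega))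
    exact Or.inl (mem_openCluster_of_edge ends hiW he haW)
  · -- an edge of T: both ends are terminal arc vertices
    obtain ⟨t, ht1, htL, htm, rfl⟩ := hT i hiT
    have he' := harc t ht1 htL
    rw [he'] at he
    have hc : c = w (t - 1) ∨ c = w t := by
      have : c ∈ s(w (t - 1), w t) := by rw [he]; exact Sym2.mem_mk_right a c
      exact Sym2.mem_iff.mp this
    right
    rcases hc with hc | hc
    · exact ⟨t - 1, by omega, by omega, hc⟩
    · exact ⟨t, by omega, htL, hc⟩


open Classical in
/-- **(G⋆)** Dropping the last edge of the arc keeps the cycle connected from `u`: with `T₁ = {e L}` (encoded as `{e t : L < t + 1}`),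
`C_u((A ∖ T₁) ∪ W) = C_u(A ∪ W)`. [cite: KozmaNitzan2024, §5.5 (context only; folklore)] -/
theorem arc_Gstar (ends : ι → Sym2 V) (L : ℕ) (hL : 1 ≤ L) (w : ℕ → V) (e : ℕ → ι) (u b : V) (hw0 : w 0 = u) (hwL : w L = b)
    (harc : ∀ t, 1 ≤ t → t ≤ L → ends (e t) = s(w (t - 1), w t))
    (heinj : ∀ s t, 1 ≤ s → s ≤ L → 1 ≤ t → t ≤ L → e s = e t → s = t)
    (A : Finset ι) (hA : ∀ i, i ∈ A ↔ ∃ t, 1 ≤ t ∧ t ≤ L ∧ e t = i)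
    (W : Finset ι) (hbW : b ∈ openCluster (ends '' (↑W : Set ι)) u) :
    openCluster (ends '' (↑((A \ A.filter (fun i => ∃ t, 1 ≤ t ∧ t ≤ L ∧ L < t + 1 ∧ e t = i)) ∪ W) : Set ι)) u
      = openCluster (ends '' (↑(A ∪ W) : Set ι)) u := by
  set T1 : Finset ι := A.filter (fun i => ∃ t, 1 ≤ t ∧ t ≤ L ∧ L < t + 1 ∧ e t = i) with hT1
  apply Set.Subset.antisymm
  · exact openCluster_image_mono ends (Finset.union_subset_union Finset.sdiff_subset (le_refl W)) u
  · refine openCluster_subset_of_closed ends (A ∪ W) u (S := openCluster (ends '' (↑((A \ T1) ∪ W) : Set ι)) u)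
      (mem_openCluster_self _ _) ?_
    intro i hi a c he ha
    by_cases hi' : i ∈ (A \ T1) ∪ W
    · exact mem_openCluster_of_edge ends hi' he ha
    · -- i is the last edge e L
      have hiA : i ∈ A := by
        rcases Finset.mem_union.mp hi with h' | h'
        · exact h'
        · exact absurd (Finset.mem_union_right _ h') hi'
      have hiT : i ∈ T1 := by
        by_contra hn; exact hi' (Finset.mem_union_left _ (Finset.mem_sdiff.mpr ⟨hiA, hn⟩))
      obtain ⟨t, ht1, htL, htm, rfl⟩ := (Finset.mem_filter.mp hiT).2
      have htL' : t = L := by omega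
      subst htL'
      -- both ends of e L are in the target cluster
      have hwL1 : w (t - 1) ∈ openCluster (ends '' (↑((A \ T1) ∪ W) : Set ι)) u := by
        rw [← hw0]
        refine arc_reach_fwd ends t w e harc _ (t - 1) (by omega) fun t' h1 h2 => ?_
        refine Finset.mem_union_left _ (Finset.mem_sdiff.mpr ⟨(hA _).mpr ⟨t', h1, by omega, rfl⟩, fun hT => ?_⟩)
        obtain ⟨t'', h1'', hL'', hm'', heq⟩ := (Finset.mem_filter.mp hT).2
        have := heinj t'' t' h1'' hL'' h1 (by omega) heq
        omega
      have hwL2 : w t ∈ openCluster (ends '' (↑((A \ T1) ∪ W) : Set ι)) u := by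
        rw [hwL]; exact openCluster_image_mono ends Finset.subset_union_right u hbW
      have he' := harc t ht1 htL
      rw [he'] at he
      have hc : c = w (t - 1) ∨ c = w t := by
        have : c ∈ s(w (t - 1), w t) := by rw [he]; exact Sym2.mem_mk_right a c
        exact Sym2.mem_iff.mp this
      rcases hc with hc | hc
      · rw [hc]; exact hwL1
      · rw [hc]; exact hwL2

open Classical in
/-- **(YJ)** The blue cluster of `u` is `W` plus the terminal blue run: for `η ⊆ A`, `η ≠ A` with `C_u(η) ≠ {u}`,
`C_u(W ∪ (A ∖ η)) ⊆ C_u(W ∪ T_{jb})`, `T_m = {e t : L < t + m}`, `jb = Nat.findGreatest (fun m => Disjoint η (T m)) L`.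
[cite: KozmaNitzan2024, §5.5 (context only; folklore)] -/
theorem arc_YJ (ends : ι → Sym2 V) (L : ℕ) (hL : 1 ≤ L) (w : ℕ → V) (e : ℕ → ι) (u b : V) (hw0 : w 0 = u) (hwL : w L = b)
    (harc : ∀ t, 1 ≤ t → t ≤ L → ends (e t) = s(w (t - 1), w t))
    (hwinj : ∀ i j, i ≤ L → j ≤ L → w i = w j → i = j)
    (heinj : ∀ s t, 1 ≤ s → s ≤ L → 1 ≤ t → t ≤ L → e s = e t → s = t)
    (A : Finset ι) (hA : ∀ i, i ∈ A ↔ ∃ t, 1 ≤ t ∧ t ≤ L ∧ e t = i)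
    (W : Finset ι) (hWint : ∀ f ∈ W, ∀ x, x ∈ ends f → ∀ j, 1 ≤ j → j < L → x ≠ w j)
    (hbW : b ∈ openCluster (ends '' (↑W : Set ι)) u)
    (η : Finset ι) (hη : η ⊆ A) (hx : openCluster (ends '' (↑η : Set ι)) u ≠ {u}) :
    openCluster (ends '' (↑(W ∪ (A \ η)) : Set ι)) u
      ⊆ openCluster (ends '' (↑(W ∪ A.filter (fun i => ∃ t, 1 ≤ t ∧ t ≤ L ∧
          L < t + Nat.findGreatest (fun m => Disjoint η (A.filter (fun i => ∃ t, 1 ≤ t ∧ t ≤ L ∧ L < t + m ∧ e t = i))) L ∧ e t = i)) : Set ι)) u := by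
  set T : ℕ → Finset ι := fun m => A.filter (fun i => ∃ t, 1 ≤ t ∧ t ≤ L ∧ L < t + m ∧ e t = i) with hT
  set jb : ℕ := Nat.findGreatest (fun m => Disjoint η (T m)) L with hjb
  change openCluster (ends '' (↑(W ∪ (A \ η)) : Set ι)) u ⊆ openCluster (ends '' (↑(W ∪ T jb) : Set ι)) u
  have hmemT : ∀ m i, i ∈ T m ↔ i ∈ A ∧ ∃ t, 1 ≤ t ∧ t ≤ L ∧ L < t + m ∧ e t = i := fun m i => by simp only [hT, Finset.mem_filter]
  have heT : ∀ m t, 1 ≤ t → t ≤ L → L < t + m → e t ∈ T m :=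
    fun m t h1 h2 h3 => (hmemT m _).mpr ⟨(hA _).mpr ⟨t, h1, h2, rfl⟩, t, h1, h2, h3, rfl⟩
  -- e 1 is red
  have he1 : e 1 ∈ η := by
    by_contra hn
    apply hx
    apply Set.Subset.antisymm
    · intro x hx'
      obtain ⟨j, hj, rfl⟩ := arc_cluster_prefix ends L w e harc hwinj A hA η hη 1 (le_refl 1) hL hn (by rw [hw0]; exact hx')
      have : j = 0 := by omega
      subst this; rw [hw0]; rfl
    · intro x hx'; rw [Set.mem_singleton_iff.mp hx']; exact mem_openCluster_self _ _
  -- jb is admissible and maximal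
  have hdis : Disjoint η (T jb) := by
    refine Nat.findGreatest_spec (P := fun m => Disjoint η (T m)) (Nat.zero_le L) ?_
    rw [Finset.disjoint_left]
    intro i _ hiT
    obtain ⟨_, t, _, htL, htm, _⟩ := (hmemT 0 i).mp hiT
    omega
  have hmax : ∀ m, m ≤ L → Disjoint η (T m) → m ≤ jb := fun m hm hd => Nat.le_findGreatest hm hd
  have hjbL : jb ≤ L := Nat.findGreatest_le L
  -- closed-set argument
  refine openCluster_subset_of_closed ends (W ∪ (A \ η)) u (S := openCluster (ends '' (↑(W ∪ T jb) : Set ι)) u)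
    (mem_openCluster_self _ _) ?_
  intro i hi a c he ha
  rcases Finset.mem_union.mp hi with hiW | hiA
  · exact mem_openCluster_of_edge ends (Finset.mem_union_left _ hiW) he ha
  · obtain ⟨hiA', hiη⟩ := Finset.mem_sdiff.mp hiA
    obtain ⟨t, ht1, htL, rfl⟩ := (hA _).mp hiA'
    have he' := harc t ht1 htL
    -- if e t ∈ T jb the edge lies in the target graph
    by_cases hin : L < t + jb
    · exact mem_openCluster_of_edge ends (Finset.mem_union_right _ (heT jb t ht1 htL hin)) he ha
    · exfalso
      -- locate the end a
      have ha' : a = w (t - 1) ∨ a = w t := by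
        have : a ∈ s(w (t - 1), w t) := by rw [← he', he]; exact Sym2.mem_mk_left a c
        exact Sym2.mem_iff.mp this
      have hbW' : w L ∈ openCluster (ends '' (↑W : Set ι)) u := by rw [hwL]; exact hbW
      rcases arc_cluster_WT ends L w e W u hw0 harc hWint hbW' (T jb) jb (fun i hi => ((hmemT jb i).mp hi).2) ha with haW | ⟨j, hjm, hjL, hja⟩
      · -- a ∈ C_u(W): a ∈ {u, b}
        rcases ha' with ha' | ha'
        · -- a = w (t-1): t - 1 = 0 (then e 1 ∈ η, contradiction) since interior vertices avoid C_u(W)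
          by_cases ht0 : t - 1 = 0
          · have : t = 1 := by omega
            subst this; exact hiη he1
          · exact arc_W_avoids ends L w W u hw0 hwinj hWint (t - 1) (by omega) (by omega) (ha' ▸ haW)
        · -- a = w t: t = L, then e L ∉ η forces jb ≥ 1, contradiction with ¬ L < t + jb
          by_cases htL' : t = L
          · have h1 : 1 ≤ jb := by
              refine hmax 1 hL ?_
              rw [Finset.disjoint_left]
              intro i' hi' hi'T
              obtain ⟨_, t', ht'1, ht'L, ht'm, rfl⟩ := (hmemT 1 i').mp hi'T
              have : t' = L := by omega
              subst this; subst htL'; exact hiη hi'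
            omega
          · exact arc_W_avoids ends L w W u hw0 hwinj hWint t (by omega) (by omega) (ha' ▸ haW)
      · -- a = w j with L ≤ j + jb
        rcases ha' with ha' | ha'
        · have := hwinj j (t - 1) hjL (by omega) (hja.symm.trans ha')
          omega
        · have hjt := hwinj j t hjL htL (hja.symm.trans ha')
          subst hjt
          -- L = t + jb exactly; then T (jb+1) is still disjoint from η: contradiction with maximality
          have hEq : L = j + jb := by omega
          have hd' : Disjoint η (T (jb + 1)) := by
            rw [Finset.disjoint_left]
            intro i' hi' hi'T
            obtain ⟨_, t', ht'1, ht'L, ht'm, rfl⟩ := (hmemT (jb + 1) i').mp hi'T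
            by_cases hlt : L < t' + jb
            · exact Finset.disjoint_left.mp hdis hi' (heT jb t' ht'1 ht'L hlt)
            · have : t' = j := by omega
              subst this; exact hiη hi'
          have := hmax (jb + 1) (by omega) hd'
          omega

open Classical in
/-- **(Yσ)** The partial swap red-connects the blue cluster: for `η ⊆ A`, `η ≠ A`, `C_u(η) ≠ {u}`,
`C_u(W ∪ (A ∖ η)) ⊆ C_u(σ(η) ∪ W)` with `σ(η) = (η ∩ In) ∪ (Out ∖ η)` as in `…KernelMixSigmaFlip`.
[cite: KozmaNitzan2024, §5.5 (context only; folklore)] -/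
theorem arc_Ysigma (ends : ι → Sym2 V) (L : ℕ) (hL : 1 ≤ L) (w : ℕ → V) (e : ℕ → ι) (u b : V) (hw0 : w 0 = u) (hwL : w L = b)
    (harc : ∀ t, 1 ≤ t → t ≤ L → ends (e t) = s(w (t - 1), w t))
    (hwinj : ∀ i j, i ≤ L → j ≤ L → w i = w j → i = j)
    (heinj : ∀ s t, 1 ≤ s → s ≤ L → 1 ≤ t → t ≤ L → e s = e t → s = t)
    (A : Finset ι) (hA : ∀ i, i ∈ A ↔ ∃ t, 1 ≤ t ∧ t ≤ L ∧ e t = i)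
    (W : Finset ι) (hWint : ∀ f ∈ W, ∀ x, x ∈ ends f → ∀ j, 1 ≤ j → j < L → x ≠ w j)
    (hbW : b ∈ openCluster (ends '' (↑W : Set ι)) u)
    (η : Finset ι) (hη : η ⊆ A) (hx : openCluster (ends '' (↑η : Set ι)) u ≠ {u}) :
    openCluster (ends '' (↑(W ∪ (A \ η)) : Set ι)) u
      ⊆ openCluster (ends '' (↑(((η ∩ A.filter (fun i => ∀ x, x ∈ ends i → x ∈ openCluster (ends '' (↑η : Set ι)) u))
          ∪ (A.filter (fun i => ∀ x, x ∈ ends i → x ∉ openCluster (ends '' (↑η : Set ι)) u) \ η)) ∪ W) : Set ι)) u := by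
  set T : ℕ → Finset ι := fun m => A.filter (fun i => ∃ t, 1 ≤ t ∧ t ≤ L ∧ L < t + m ∧ e t = i) with hT
  set jb : ℕ := Nat.findGreatest (fun m => Disjoint η (T m)) L with hjb
  set X : Set V := openCluster (ends '' (↑η : Set ι)) u with hX
  set σ : Finset ι := (η ∩ A.filter (fun i => ∀ x, x ∈ ends i → x ∈ X)) ∪ (A.filter (fun i => ∀ x, x ∈ ends i → x ∉ X) \ η) with hσ
  set S : Set V := openCluster (ends '' (↑(σ ∪ W) : Set ι)) u with hS
  have hmemT : ∀ m i, i ∈ T m ↔ i ∈ A ∧ ∃ t, 1 ≤ t ∧ t ≤ L ∧ L < t + m ∧ e t = i := fun m i => by simp only [hT, Finset.mem_filter]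
  have step1 := arc_YJ ends L hL w e u b hw0 hwL harc hwinj heinj A hA W hWint hbW η hη hx
  change openCluster (ends '' (↑(W ∪ (A \ η)) : Set ι)) u ⊆ openCluster (ends '' (↑(W ∪ T jb) : Set ι)) u at step1
  refine le_trans step1 ?_
  have hdis : Disjoint η (T jb) := by
    refine Nat.findGreatest_spec (P := fun m => Disjoint η (T m)) (Nat.zero_le L) ?_
    rw [Finset.disjoint_left]
    intro i _ hiT
    obtain ⟨_, t, _, htL, htm, _⟩ := (hmemT 0 i).mp hiT
    omega
  have hjbL : jb ≤ L := Nat.findGreatest_le L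
  -- the red cluster X in S
  have hXS : X ⊆ S := by
    have c1 := openCluster_sigmaFlip ends A η u hη
    change openCluster (ends '' (↑σ : Set ι)) u = X at c1
    rw [← c1]; exact openCluster_image_mono ends Finset.subset_union_left u
  have hWS : openCluster (ends '' (↑W : Set ι)) u ⊆ S := openCluster_image_mono ends Finset.subset_union_right u
  -- all vertices of the terminal segment are in S (downward induction from b)
  have seg : ∀ n j, j + n = L → L ≤ j + jb → w j ∈ S := by
    intro n
    induction n with
    | zero =>
      intro j hj _
      have : j = L := by omega
      subst this; rw [hwL]; exact hWS hbW
    | succ n ih =>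
      intro j hj hjb
      have hnext : w (j + 1) ∈ S := ih (j + 1) (by omega) (by omega)
      by_cases hwj : w j ∈ X
      · exact hXS hwj
      · -- the blue edge e (j+1) lies away from X, hence in σ
        have hej : e (j + 1) ∉ η := fun hin =>
          Finset.disjoint_left.mp hdis hin ((hmemT jb _).mpr ⟨(hA _).mpr ⟨j + 1, by omega, by omega, rfl⟩, j + 1, by omega, by omega, by omega, rfl⟩)
        have hwj1 : w (j + 1) ∉ X := by
          intro hin
          obtain ⟨j', hj', hjj'⟩ := arc_cluster_prefix ends L w e harc hwinj A hA η hη (j + 1) (by omega) (by omega) hej (by rw [hw0]; exact hin)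
          have := hwinj (j + 1) j' (by omega) (by omega) hjj'
          omega
        have hedge := harc (j + 1) (by omega) (by omega)
        simp only [Nat.add_sub_cancel] at hedge
        have hout : e (j + 1) ∈ σ := by
          refine Finset.mem_union_right _ (Finset.mem_sdiff.mpr ⟨Finset.mem_filter.mpr ⟨(hA _).mpr ⟨j + 1, by omega, by omega, rfl⟩, ?_⟩, hej⟩)
          intro x hx'
          rw [hedge, Sym2.mem_iff] at hx'
          rcases hx' with rfl | rfl
          · exact hwj
          · exact hwj1
        exact mem_openCluster_of_edge ends (Finset.mem_union_left _ hout) (hedge.trans Sym2.eq_swap) hnext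
  -- closed-set argument on the target S
  refine openCluster_subset_of_closed ends (W ∪ T jb) u (S := S) (mem_openCluster_self _ _) ?_
  intro i hi a c he ha
  rcases Finset.mem_union.mp hi with hiW | hiT
  · exact mem_openCluster_of_edge ends (Finset.mem_union_right _ hiW) he ha
  · obtain ⟨_, t, ht1, htL, htm, rfl⟩ := (hmemT jb _).mp hiT
    have he' := harc t ht1 htL
    rw [he'] at he
    have hc : c = w (t - 1) ∨ c = w t := by
      have : c ∈ s(w (t - 1), w t) := by rw [he]; exact Sym2.mem_mk_right a c
      exact Sym2.mem_iff.mp this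
    rcases hc with hc | hc
    · rw [hc]; exact seg (L - (t - 1)) (t - 1) (by omega) (by omega)
    · rw [hc]; exact seg (L - t) t (by omega) (by omega)

end Coefficientwise

end Summit.CriticalPhenomena.PercolationContinuityZ3.Theorems
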